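import Summits.NavierStokesRegularity.NavierStokesRegularity.Theorems.IsotropicBlobWitnessFieldDeriv
import Summits.NavierStokesRegularity.NavierStokesRegularity.Theorems.HarmonicShellLineGlue
import HarnessLib

/-!
# THE `C²` WITNESS FIELD of ROUND-41 — the sphere, global differentiability, `div u = 0`, `C²`
(plate (V), parts V5 (sphere/closed exterior), V4, V2; LEAD S-door ns-s30-p1 g4 PLATE MAP v3 2026-08-28;
texts nsreg-p1 g33 `r41/Sketch45.lean`; defs `Theorems/IsotropicBlobDefs.lean` p674102; plate L `HarmonicShellLineGlue`)

Cell `ns-regularity-ideate`, seat ns-sfl-p1 g6, `--supports stmt-NavierStokesRegularity-0056 --as helper`.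

* `norm_witnessFieldC2_le_of_lt` — `‖u y‖ ≤ (16/3)(1−‖y‖²)³` inside; `norm_witnessFieldC2_le_sq_dist` — on the unit
  sphere `‖x‖² = 1`: `‖u y‖ ≤ (64/3)‖y − x‖²` for EVERY `y`;
* (V5, sphere) `hasFDerivAt_witnessFieldC2_of_eq_one` — `Du(x) = 0` at `‖x‖² = 1`; `hasFDerivAt_witnessFieldC2_of_le`,
  **`fderiv_witnessFieldC2_of_le : 1 ≤ ‖x‖² → fderiv ℝ witnessFieldC2 x = 0`**, `differentiable_witnessFieldC2`;
* (V4) `traceCLM_uniaxialS = 0`, `traceCLM_id_E3 = 3`, `divergence_witnessFieldC2 : div u x = 0`,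
  **`isDivFree_witnessFieldC2 : IsDivFree witnessFieldC2`** (inside: `tr Du = q·(2a′ + 5b + 2b′s) = 0` by `ring`);
* (V2) `polyEnv_four_eq_lineGlue`, `dpolyEnv_four_eq_lineGlue`, `contDiff_two_polyEnv_four_comp_norm_sq`,
  `contDiff_two_dpolyEnv_four_comp_norm_sq`, **`contDiff_two_witnessFieldC2 : ContDiff ℝ 2 witnessFieldC2`**
  (plate L `contDiff_two_lineGlue_comp_norm_sq` with the 2-jets `(1−s)⁴ : 0,0,0` and `−4(1−s)³ : 0,0,0` at `s = 1`).

HONEST FRAMING: kinematic slice witness calculus; item 0056 `NoTypeII` and NS regularity NOT proved; no summit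
statement is proved by this seat.
-/

noncomputable section

open MeasureTheory Set Function Filter Metric Real InnerProductSpace
open _root_.Topology
open scoped ENNReal NNReal RealInnerProductSpace ContDiff Laplacian
open Literature.Analysis Literature.Analysis.FluidPDE VectorCalculus

namespace Summit.NavierStokesRegularity.NavierStokesRegularity.Theorems.StrainDoors.IsotropicBlob

open Summit.NavierStokesRegularity.NavierStokesRegularity.Theorems.ArgmaxDoors
open Summit.NavierStokesRegularity.NavierStokesRegularity.Theorems.StrainDoors
open Summit.NavierStokesRegularity.NavierStokesRegularity.Theorems.StrainDoors.HarmonicShell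

set_option linter.dupNamespace false

/-! ## §1 Size of the witness near the sphere -/

/-- `‖Sy‖ ≤ ‖y‖` for the uniaxial strain `S = diag(−½,−½,1)`. -/
theorem norm_uniaxialS_le (y : E3) : ‖uniaxialS y‖ ≤ ‖y‖ := by
  have h1 : ‖uniaxialS y‖ ^ 2 ≤ ‖y‖ ^ 2 := by
    obtain ⟨h0, h1, h2⟩ := uniaxialS_apply y
    rw [EuclideanSpace.norm_sq_eq, EuclideanSpace.norm_sq_eq, Fin.sum_univ_three, Fin.sum_univ_three]
    simp only [Real.norm_eq_abs, sq_abs, h0, h1, h2]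
    nlinarith [sq_nonneg (y 0), sq_nonneg (y 1)]
  exact (sq_le_sq₀ (norm_nonneg _) (norm_nonneg _)).1 h1

/-- `|⟪y, Sy⟫| ≤ ‖y‖²`. -/
theorem abs_inner_uniaxialS_le (y : E3) : |⟪y, uniaxialS y⟫| ≤ ‖y‖ ^ 2 := by
  calc |⟪y, uniaxialS y⟫| ≤ ‖y‖ * ‖uniaxialS y‖ := abs_real_inner_le_norm _ _
    _ ≤ ‖y‖ * ‖y‖ := mul_le_mul_of_nonneg_left (norm_uniaxialS_le y) (norm_nonneg _)
    _ = ‖y‖ ^ 2 := (sq _).symm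

/-- Inside the ball: `‖u y‖ ≤ (16/3)(1 − ‖y‖²)³`. -/
theorem norm_witnessFieldC2_le_of_lt {y : E3} (hy : ‖y‖ ^ 2 < 1) :
    ‖witnessFieldC2 y‖ ≤ 16 / 3 * (1 - ‖y‖ ^ 2) ^ 3 := by
  rw [witnessFieldC2_eq_of_lt hy]
  have hy1 : ‖y‖ ≤ 1 := by nlinarith [norm_nonneg y]
  have hs0 : 0 ≤ 1 - ‖y‖ ^ 2 := by linarith
  have hs3 : 0 ≤ (1 - ‖y‖ ^ 2) ^ 3 := pow_nonneg hs0 3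
  have ha : |(1 - ‖y‖ ^ 2) ^ 3 * (1 - 11 * ‖y‖ ^ 2 / 3)| ≤ 8 / 3 * (1 - ‖y‖ ^ 2) ^ 3 := by
    rw [abs_mul, abs_of_nonneg hs3]
    have h : |1 - 11 * ‖y‖ ^ 2 / 3| ≤ 8 / 3 :=
      abs_le.2 ⟨by nlinarith [sq_nonneg ‖y‖], by nlinarith [sq_nonneg ‖y‖]⟩
    calc (1 - ‖y‖ ^ 2) ^ 3 * |1 - 11 * ‖y‖ ^ 2 / 3| ≤ (1 - ‖y‖ ^ 2) ^ 3 * (8 / 3) :=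
        mul_le_mul_of_nonneg_left h hs3
      _ = 8 / 3 * (1 - ‖y‖ ^ 2) ^ 3 := by ring
  have hb : |8 / 3 * (1 - ‖y‖ ^ 2) ^ 3 * ⟪y, uniaxialS y⟫| ≤ 8 / 3 * (1 - ‖y‖ ^ 2) ^ 3 := by
    have h83 : 0 ≤ 8 / 3 * (1 - ‖y‖ ^ 2) ^ 3 := mul_nonneg (by norm_num) hs3
    rw [abs_mul, abs_of_nonneg h83]
    calc 8 / 3 * (1 - ‖y‖ ^ 2) ^ 3 * |⟪y, uniaxialS y⟫| ≤ 8 / 3 * (1 - ‖y‖ ^ 2) ^ 3 * ‖y‖ ^ 2 :=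
        mul_le_mul_of_nonneg_left (abs_inner_uniaxialS_le y) h83
      _ ≤ 8 / 3 * (1 - ‖y‖ ^ 2) ^ 3 * 1 := mul_le_mul_of_nonneg_left hy.le h83
      _ = 8 / 3 * (1 - ‖y‖ ^ 2) ^ 3 := mul_one _
  calc ‖((1 - ‖y‖ ^ 2) ^ 3 * (1 - 11 * ‖y‖ ^ 2 / 3)) • uniaxialS y +
          (8 / 3 * (1 - ‖y‖ ^ 2) ^ 3 * ⟪y, uniaxialS y⟫) • y‖
        ≤ ‖((1 - ‖y‖ ^ 2) ^ 3 * (1 - 11 * ‖y‖ ^ 2 / 3)) • uniaxialS y‖ +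
          ‖(8 / 3 * (1 - ‖y‖ ^ 2) ^ 3 * ⟪y, uniaxialS y⟫) • y‖ := norm_add_le _ _
    _ = |(1 - ‖y‖ ^ 2) ^ 3 * (1 - 11 * ‖y‖ ^ 2 / 3)| * ‖uniaxialS y‖ +
          |8 / 3 * (1 - ‖y‖ ^ 2) ^ 3 * ⟪y, uniaxialS y⟫| * ‖y‖ := by
        rw [norm_smul, norm_smul, Real.norm_eq_abs, Real.norm_eq_abs]
    _ ≤ 8 / 3 * (1 - ‖y‖ ^ 2) ^ 3 * 1 + 8 / 3 * (1 - ‖y‖ ^ 2) ^ 3 * 1 :=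
        add_le_add (mul_le_mul ha ((norm_uniaxialS_le y).trans hy1) (norm_nonneg _) (by positivity))
          (mul_le_mul hb hy1 (norm_nonneg _) (by positivity))
    _ = 16 / 3 * (1 - ‖y‖ ^ 2) ^ 3 := by ring

/-- **On the unit sphere the witness is `O(dist²)`**: for `‖x‖² = 1` and every `y`, `‖u y‖ ≤ (64/3)‖y − x‖²`. -/
theorem norm_witnessFieldC2_le_sq_dist {x : E3} (hx : ‖x‖ ^ 2 = 1) (y : E3) :
    ‖witnessFieldC2 y‖ ≤ 64 / 3 * ‖y - x‖ ^ 2 := by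
  by_cases hy : ‖y‖ ^ 2 < 1
  · have hx1 : ‖x‖ = 1 := (pow_eq_one_iff_of_nonneg (norm_nonneg x) two_ne_zero).1 hx
    have hy1 : ‖y‖ < 1 := by nlinarith [norm_nonneg y]
    have hxy : 1 - ‖y‖ ≤ ‖y - x‖ := by
      have h := abs_norm_sub_norm_le x y
      rw [hx1, norm_sub_rev x y] at h
      exact (le_abs_self _).trans h
    have h1 : 1 - ‖y‖ ^ 2 ≤ 2 * ‖y - x‖ := by
      nlinarith [hxy, norm_nonneg y, hy1.le, norm_nonneg (y - x)]
    have hs0 : 0 ≤ 1 - ‖y‖ ^ 2 := by linarith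
    have hs1 : 1 - ‖y‖ ^ 2 ≤ 1 := by linarith [sq_nonneg ‖y‖]
    have h2 : (1 - ‖y‖ ^ 2) ^ 3 ≤ 4 * ‖y - x‖ ^ 2 :=
      calc (1 - ‖y‖ ^ 2) ^ 3 = (1 - ‖y‖ ^ 2) * (1 - ‖y‖ ^ 2) ^ 2 := by ring
        _ ≤ 1 * (2 * ‖y - x‖) ^ 2 := mul_le_mul hs1 (pow_le_pow_left₀ hs0 h1 2) (sq_nonneg _) zero_le_one
        _ = 4 * ‖y - x‖ ^ 2 := by ring
    calc ‖witnessFieldC2 y‖ ≤ 16 / 3 * (1 - ‖y‖ ^ 2) ^ 3 := norm_witnessFieldC2_le_of_lt hy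
      _ ≤ 16 / 3 * (4 * ‖y - x‖ ^ 2) := by gcongr
      _ = 64 / 3 * ‖y - x‖ ^ 2 := by ring
  · rw [witnessFieldC2_eq_zero_of_le (not_lt.1 hy), norm_zero]
    positivity

/-! ## §2 (V5, sphere and closed exterior) The derivative vanishes on `1 ≤ ‖x‖²` -/

/-- **(V5) ON THE SPHERE**: `Du(x) = 0` at `‖x‖² = 1` (the `O(dist²)` bound). -/
theorem hasFDerivAt_witnessFieldC2_of_eq_one {x : E3} (hx : ‖x‖ ^ 2 = 1) :
    HasFDerivAt witnessFieldC2 (0 : E3 →L[ℝ] E3) x := by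
  rw [hasFDerivAt_iff_isLittleO_nhds_zero]
  have hx0 : witnessFieldC2 x = 0 := witnessFieldC2_eq_zero_of_le hx.ge
  simp only [hx0, sub_zero, zero_apply]
  refine Asymptotics.IsBigO.trans_isLittleO (g := fun h : E3 => ‖h‖ ^ 2) ?_
    (Asymptotics.isLittleO_norm_pow_id one_lt_two)
  refine Asymptotics.IsBigO.of_bound (64 / 3) (Filter.Eventually.of_forall fun h => ?_)
  have hb := norm_witnessFieldC2_le_sq_dist hx (x + h)
  rw [add_sub_cancel_left] at hb
  simpa only [norm_pow, norm_norm] using hb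

/-- `Du(x) = 0` as a `HasFDerivAt` for `‖x‖² > 1` (locally zero). -/
theorem hasFDerivAt_witnessFieldC2_of_gt {x : E3} (hx : 1 < ‖x‖ ^ 2) :
    HasFDerivAt witnessFieldC2 (0 : E3 →L[ℝ] E3) x := by
  have hopen : IsOpen {y : E3 | 1 < ‖y‖ ^ 2} := isOpen_lt continuous_const (continuous_norm.pow 2)
  have hev : witnessFieldC2 =ᶠ[𝓝 x] fun _ => (0 : E3) :=
    Filter.eventually_of_mem (hopen.mem_nhds hx) fun y hy => witnessFieldC2_eq_zero_of_le (le_of_lt hy)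
  exact (hasFDerivAt_const (0 : E3) x).congr_of_eventuallyEq hev

/-- **(V5) ON THE CLOSED EXTERIOR**: `Du(x) = 0` for `1 ≤ ‖x‖²` (sphere included). -/
theorem hasFDerivAt_witnessFieldC2_of_le {x : E3} (hx : 1 ≤ ‖x‖ ^ 2) :
    HasFDerivAt witnessFieldC2 (0 : E3 →L[ℝ] E3) x := by
  rcases hx.eq_or_lt with h | h
  · exact hasFDerivAt_witnessFieldC2_of_eq_one h.symm
  · exact hasFDerivAt_witnessFieldC2_of_gt h

/-- **(V5)** `fderiv ℝ witnessFieldC2 x = 0` for `1 ≤ ‖x‖²` (sphere included). -/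
theorem fderiv_witnessFieldC2_of_le {x : E3} (hx : 1 ≤ ‖x‖ ^ 2) : fderiv ℝ witnessFieldC2 x = 0 :=
  (hasFDerivAt_witnessFieldC2_of_le hx).fderiv

/-- The witness field is differentiable everywhere. -/
theorem differentiable_witnessFieldC2 : Differentiable ℝ witnessFieldC2 := fun x => by
  by_cases hx : ‖x‖ ^ 2 < 1
  · exact (hasFDerivAt_witnessFieldC2_of_lt hx).differentiableAt
  · exact (hasFDerivAt_witnessFieldC2_of_le (not_lt.1 hx)).differentiableAt

/-! ## §3 (V4) The witness field is divergence free -/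

/-- `tr S = 0` for the uniaxial strain. -/
theorem traceCLM_uniaxialS : traceCLM uniaxialS = 0 := by
  rw [traceCLM_eq_sum_inner (EuclideanSpace.basisFun (Fin 3) ℝ), Fin.sum_univ_three]
  obtain ⟨h0, -, -⟩ := uniaxialS_apply (EuclideanSpace.single (0 : Fin 3) (1 : ℝ))
  obtain ⟨-, h1, -⟩ := uniaxialS_apply (EuclideanSpace.single (1 : Fin 3) (1 : ℝ))
  obtain ⟨-, -, h2⟩ := uniaxialS_apply (EuclideanSpace.single (2 : Fin 3) (1 : ℝ))
  simp only [EuclideanSpace.basisFun_apply, EuclideanSpace.inner_single_left, map_one, one_mul, h0, h1, h2]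
  simp

/-- `tr id = 3` on `ℝ³`. -/
theorem traceCLM_id_E3 : traceCLM (ContinuousLinearMap.id ℝ E3) = 3 := by
  rw [traceCLM_apply, ContinuousLinearMap.coe_id, LinearMap.trace_id, finrank_euclideanSpace_fin]
  norm_num

/-- **(V4) `div u = 0` everywhere**: inside, `tr Du(x) = ⟪x,Sx⟫·(2a′ + 5b + 2b′‖x‖²) = 0`; outside and on the
sphere `Du = 0`. -/
theorem divergence_witnessFieldC2 (x : E3) : VectorCalculus.divergence witnessFieldC2 x = 0 := by
  rw [divergence_eq_traceCLM]
  by_cases hx : ‖x‖ ^ 2 < 1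
  · rw [(hasFDerivAt_witnessFieldC2_of_lt hx).fderiv]
    simp only [map_add, map_smul, traceCLM_smulRight, traceCLM_uniaxialS, traceCLM_id_E3, smul_eq_mul, mul_zero,
      _root_.smul_apply, _root_.add_apply, innerSL_apply_apply, real_inner_self_eq_norm_sq]
    rw [real_inner_comm x (uniaxialS x)]
    ring
  · rw [fderiv_witnessFieldC2_of_le (not_lt.1 hx), map_zero]

/-- **(V4)** `IsDivFree witnessFieldC2`. -/
theorem isDivFree_witnessFieldC2 : IsDivFree witnessFieldC2 := fun x => divergence_witnessFieldC2 x

/-! ## §4 (V2) The witness field is `C²` (plate L «LineGlue») -/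

/-- `d/ds (1−s)ⁿ = −n(1−s)ⁿ⁻¹`. -/
theorem hasDerivAt_one_sub_pow (n : ℕ) (s : ℝ) :
    HasDerivAt (fun s : ℝ => (1 - s) ^ n) (-(n : ℝ) * (1 - s) ^ (n - 1)) s :=
  (((hasDerivAt_id' s).const_sub 1).pow n).congr_deriv (by ring)

/-- `deriv (1−s)ⁿ = −n(1−s)ⁿ⁻¹`. -/
theorem deriv_one_sub_pow (n : ℕ) : deriv (fun s : ℝ => (1 - s) ^ n) = fun s => -(n : ℝ) * (1 - s) ^ (n - 1) :=
  funext fun s => (hasDerivAt_one_sub_pow n s).deriv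

/-- `deriv (c(1−s)ⁿ) = −cn(1−s)ⁿ⁻¹`. -/
theorem deriv_const_mul_one_sub_pow (c : ℝ) (n : ℕ) :
    deriv (fun s : ℝ => c * (1 - s) ^ n) = fun s => c * (-(n : ℝ) * (1 - s) ^ (n - 1)) :=
  funext fun s => ((hasDerivAt_one_sub_pow n s).const_mul c).deriv

/-- `polyEnv 4 = lineGlue 1 (1−s)⁴ 0`. -/
theorem polyEnv_four_eq_lineGlue : polyEnv 4 = lineGlue 1 (fun s => (1 - s) ^ 4) (fun _ => 0) := by
  funext s
  rcases lt_trichotomy s 1 with h | rfl | h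
  · rw [lineGlue_of_le h.le]; simp only [polyEnv, if_pos h]
  · simp [polyEnv, lineGlue]
  · rw [lineGlue_of_lt h]; simp only [polyEnv, if_neg (not_lt.2 h.le)]

/-- `dpolyEnv 4 = lineGlue 1 (−4(1−s)³) 0`. -/
theorem dpolyEnv_four_eq_lineGlue : dpolyEnv 4 = lineGlue 1 (fun s => -4 * (1 - s) ^ 3) (fun _ => 0) := by
  funext s
  rcases lt_trichotomy s 1 with h | rfl | h
  · rw [lineGlue_of_le h.le]; simp only [dpolyEnv, if_pos h]; norm_num
  · simp [dpolyEnv, lineGlue]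
  · rw [lineGlue_of_lt h]; simp only [dpolyEnv, if_neg (not_lt.2 h.le)]

/-- `x ↦ polyEnv 4 (‖x‖²)` is `C²` (2-jet of `(1−s)⁴` at `s = 1` is `0`). -/
theorem contDiff_two_polyEnv_four_comp_norm_sq : ContDiff ℝ 2 (fun x : E3 => polyEnv 4 (‖x‖ ^ 2)) := by
  rw [polyEnv_four_eq_lineGlue]
  have hf : ContDiff ℝ 2 (fun s : ℝ => (1 - s) ^ 4) := (contDiff_const.sub contDiff_id).pow 4
  refine contDiff_two_lineGlue_comp_norm_sq (fun s _ => hf.contDiffAt) (fun s _ => contDiffAt_const) ?_ ?_ ?_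
  · norm_num
  · rw [deriv_one_sub_pow, deriv_const]; norm_num
  · rw [deriv_one_sub_pow, deriv_const', deriv_const_mul_one_sub_pow, deriv_const]; norm_num

/-- `x ↦ dpolyEnv 4 (‖x‖²)` is `C²` (2-jet of `−4(1−s)³` at `s = 1` is `0`). -/
theorem contDiff_two_dpolyEnv_four_comp_norm_sq : ContDiff ℝ 2 (fun x : E3 => dpolyEnv 4 (‖x‖ ^ 2)) := by
  rw [dpolyEnv_four_eq_lineGlue]
  have hf : ContDiff ℝ 2 (fun s : ℝ => -4 * (1 - s) ^ 3) := contDiff_const.mul ((contDiff_const.sub contDiff_id).pow 3)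
  refine contDiff_two_lineGlue_comp_norm_sq (fun s _ => hf.contDiffAt) (fun s _ => contDiffAt_const) ?_ ?_ ?_
  · norm_num
  · rw [deriv_const_mul_one_sub_pow, deriv_const]; norm_num
  · rw [deriv_const_mul_one_sub_pow, deriv_const']
    have h : (fun s : ℝ => -4 * (-((3 : ℕ) : ℝ) * (1 - s) ^ (3 - 1))) = fun s => 12 * (1 - s) ^ 2 := by
      funext s; norm_num; ring
    rw [h, deriv_const_mul_one_sub_pow, deriv_const]; norm_num

/-- The witness as an explicit envelope expression (the `k • W` term is `0`). -/
theorem witnessFieldC2_eq_fun : witnessFieldC2 = fun x : E3 =>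
    (polyEnv 4 (‖x‖ ^ 2) + 2 / 3 * ‖x‖ ^ 2 * dpolyEnv 4 (‖x‖ ^ 2)) • uniaxialS x -
      (2 / 3 * dpolyEnv 4 (‖x‖ ^ 2) * ⟪x, uniaxialS x⟫) • x := by
  funext x
  change isoField uniaxialS 0 (polyEnv 4) (dpolyEnv 4) 0 x = _
  unfold isoField
  simp

/-- **(V2) THE WITNESS FIELD IS `C²`.** -/
theorem contDiff_two_witnessFieldC2 : ContDiff ℝ 2 witnessFieldC2 := by
  rw [witnessFieldC2_eq_fun]
  have hP := contDiff_two_polyEnv_four_comp_norm_sq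
  have hD := contDiff_two_dpolyEnv_four_comp_norm_sq
  have hN : ContDiff ℝ 2 (fun x : E3 => ‖x‖ ^ 2) := contDiff_norm_sq ℝ
  have hS : ContDiff ℝ 2 (fun x : E3 => uniaxialS x) := uniaxialS.contDiff
  have hq : ContDiff ℝ 2 (fun x : E3 => ⟪x, uniaxialS x⟫) := contDiff_id.inner ℝ hS
  exact ((hP.add ((contDiff_const.mul hN).mul hD)).smul hS).sub (((contDiff_const.mul hD).mul hq).smul contDiff_id)

end Summit.NavierStokesRegularity.NavierStokesRegularity.Theorems.StrainDoors.IsotropicBlob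

end
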